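import Literature.MathematicalPhysics.QuantumLattice.FermionOperators
import HarnessLib

/-!
# Discharge of `nParticleSubmodule_eq_eigenspace`: the `N`-particle sector is the `N`-eigenspace of `N̂`

Trunk T-QLATTICE, family `hubbard`. Sibling proof file of
`Literature/MathematicalPhysics/QuantumLattice/FermionOperators.lean`; no statement is introduced
or changed.

Proved here: for every `N : ℕ`, the `N`-particle sector
`nParticleSubmodule N = {ψ | IsNParticle N ψ}` (vectors supported on occupation basis states
`|s⟩` with `#s = N`) coincides with the eigenspace of the total number operator
`N̂ = Σ_i n_i` (`totalNumberOp`, acting through `Matrix.toLin'`) for the eigenvalue `N` — the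
statement `Literature.MathematicalPhysics.QuantumLattice.nParticleSubmodule_eq_eigenspace`,
discharged as `nParticleSubmodule_eq_eigenspace_holds`.

In the source this is the *definition* of the `N`-electron Hilbert space: Tasaki,
*The Hubbard model — an introduction and selected rigorous results* (1998; arXiv:cond-mat/9512169)
§2.2 defines the total number operator `N̂_e = Σ_{x ∈ Λ} (n_{x↑} + n_{x↓})` and then works in
"the Hilbert space in which the number operator `N̂_e` has a fixed eigenvalue `N_e`"; the book
version is Tasaki (2020) §9.2. In the wave-0 model `IsNParticle` is instead stated through
supports in the occupation basis, so the identification is a (short) theorem: by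
`totalNumberOp_eq_diagonal` (proved in `FermionOperators.lean`) `N̂` is the diagonal matrix
`|s⟩ ↦ #s |s⟩`, hence `N̂ ψ = N ψ` reads `#s · ψ(s) = N · ψ(s)` for every `s`, i.e. `ψ(s) = 0`
whenever `#s ≠ N` (`ℕ → ℂ` is injective and `ℂ` has no zero divisors), which is `IsNParticle N ψ`.

## Sources

H. Tasaki, *The Hubbard model — an introduction and selected rigorous results*, J. Phys.:
Condens. Matter **10** (1998) 4353, arXiv:cond-mat/9512169, §2.2 ("Some physical quantities");
H. Tasaki, *Physics and Mathematics of Quantum Many-Body Systems*, Springer GTP (2020), §9.2.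
-/

namespace Literature.MathematicalPhysics.QuantumLattice

open Matrix Finset

variable {ι : Type*} [LinearOrder ι] [Fintype ι]

/-- **Discharge of `Literature.MathematicalPhysics.QuantumLattice.nParticleSubmodule_eq_eigenspace`**:
the `N`-particle sector `{ψ | IsNParticle N ψ}` is exactly the eigenspace of the total number
operator `N̂ = Σ_i n_i` for the eigenvalue `N`. The source *defines* the `N`-electron Hilbert
space as the subspace "in which the number operator `N̂_e` has a fixed eigenvalue `N_e`"
(Tasaki (1998) §2.2, the display `N̂_e = Σ_{x ∈ Λ} (n_{x↑} + n_{x↓})` and the sentence following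
it; Tasaki (2020) §9.2); here it is a theorem because wave 0 states `IsNParticle` through
supports in the occupation basis, and `N̂ |s⟩ = #s |s⟩` (`totalNumberOp_eq_diagonal`).
[cite: Tasaki2020, §9.2] [cite: Tasaki1998, §2.2] -/
theorem nParticleSubmodule_eq_eigenspace_holds : nParticleSubmodule_eq_eigenspace (ι := ι) := by
  intro N
  ext ψ
  rw [mem_nParticleSubmodule_iff, Module.End.mem_eigenspace_iff, Matrix.toLin'_apply,
    totalNumberOp_eq_diagonal]
  constructor
  · intro h
    funext s
    rw [mulVec_diagonal, Pi.smul_apply, smul_eq_mul]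
    by_cases hs : s.card = N
    · rw [hs]
    · rw [h s hs, mul_zero, mul_zero]
  · intro h s hs
    have h' := congr_fun h s
    rw [mulVec_diagonal, Pi.smul_apply, smul_eq_mul] at h'
    have hne : (s.card : ℂ) ≠ (N : ℂ) := by exact_mod_cast hs
    exact (mul_eq_mul_right_iff.mp h').resolve_left hne

end Literature.MathematicalPhysics.QuantumLattice
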